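import Literature.AlgebraicGeometry.Motives.AbelianVarietyVerschiebungDegree
import HarnessLib

/-!
# The dual of the Verschiebung is the Frobenius: `(V_A)^∨ = F_{Â}` — the twin of ★ (DF) `(F_A)^∨ = V_{Â}`
# ([Oda1969] §1 Cor. 1.3; [MumfordAV1970] §15 Thm. 1; EGM (5.21) ∕ (7.34))

Layer `Literature/AlgebraicGeometry/AbelianSchemes`, namespaces `Literature.AlgebraicGeometry.Motives.AbelianVariety` (§1) and
`Literature.AlgebraicGeometry.AbelianSchemes.AbelianSchemeOver.DualPair` (§2).  THEOREMS ONLY (+ one `private` plumbing copy of ★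
`dualIsogeny_congr`; no definition, no named fact, no instance, no notation, no `sorry`; net Literature debt 0).  Cell `hodgecm-mathlib`
(D-0151), programme F0/P6 «MOD», the `w`-block ∕ (rL) supplier road (desk F0P6b-plan): the identity the (W2) dock of the line
«F0_P6b_WeilCartierDuality» needs to read `IsNatural` at `f := V^{(r)}_A` (the `V`-square of ★ `AbelianVarietyFrobeniusKernelAnnihilator`);
`--supports stmt-HodgeConjecture-24832`, count-neutral.  HONEST LABEL: HC_CM is proved only modulo the 2 remaining named inputs
(hLiu418 24832, h413 24833) until rung 0 closes; this file discharges none of them.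

THE MATHEMATICS.  `k` perfect of characteristic `p`, `q = p^m`, `A∕k` an abelian variety with a dual pair `D = (Â, 𝒫)` satisfying the unit
hypothesis `𝒫|_{A × {ε}} ≅ 𝒪`, `D^{(q)} = (Â^{(q)}, 𝒫^{(q)})` the dual pair of the Frobenius twist (★ (DF-1) `DualPair.frobeniusTwist`),
`F = F_{A∕k} : A → A^{(q)}`, and `V : A^{(q)} → A` ANY homomorphism with `F ≫ V = [q]_A` (the Verschiebung, ★
`existsUnique_relFrobenius_comp_eq_pow_zsmul_id`).
* §1 `comp_relFrobenius_eq_zsmul_id_of_relFrobenius_comp_eq` — **`V ≫ F = [q]_{A^{(q)}}`** (`F ≫ (V ≫ F) = [q] ≫ F = F ≫ [q]` and `F` is an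
  isogeny, ★ `IsIsogeny.cancel_left`).
* §2 **`dualIsogenyOver_verschiebung_eq_relFrobenius`** — **`V^∨ = F_{Â}`** as `k`-morphisms `Â → Â^{(q)}` (`V^∨ := dualIsogenyOver V D^{(q)} D`):
  with `V_{Â} := ` the Verschiebung of `Â` one has `V_{Â} = F^∨` (★ (DF) `hom_eq_dualIsogenyOver_relFrobenius`), so
  `V_{Â} ≫ V^∨ = F^∨ ≫ V^∨ = (V ≫ F)^∨` (★ `dualIsogenyOver_comp`) `= ([q]_{A^{(q)}})^∨` (§1) `= [q]_{Â^{(q)}}` (★ `dualIsogenyOver_mulN` for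
  `D^{(q)}`, unit hypothesis ★ `nonempty_unitHatSlice_frobeniusTwist_iso`); and `V_{Â} ≫ F_{Â} = [q]_{Â^{(q)}}` (§1 for `Â`); cancel the isogeny
  `V_{Â}` on the left (★ `isIsogeny_of_relFrobenius_comp_eq_zsmul_id`, ★ `IsIsogeny.cancel_left`) — `V^∨` being packaged as a morphism of
  abelian varieties by ★ `homOfIsMonHom` (★ `isMonHom_dualIsogenyOver`).

## References
* [Oda1969] T. Oda, *The first de Rham cohomology group and Dieudonné modules*, Ann. Sci. ÉNS (4) 2 (1969), §1 Cor. 1.3.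
* [MumfordAV1970] D. Mumford, *Abelian Varieties* (1970), §15 Thm. 1 (p. 143).
* [EdixhovenVanDerGeerMoonenAV] B. Edixhoven, G. van der Geer, B. Moonen, *Abelian Varieties* (draft), Ch. 5 §2 (`F ∘ V = [p] = V ∘ F`), (5.21), (7.34).
* [GortzWedhorn2023] U. Görtz, T. Wedhorn, *Algebraic Geometry II* (2023), Prop. 27.182 (p. 885).
* [MilneAV2008] J. S. Milne, *Abelian Varieties* (2008), I §9 Thm. 9.1 (p. 42).
-/

set_option autoImplicit false

-- `Scheme.Modules` / `SheafOfModules` are not reducible (as in ★ `DualIsogenyRelFrobenius`).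
set_option backward.isDefEq.respectTransparency false

noncomputable section

universe u

open CategoryTheory CategoryTheory.Limits AlgebraicGeometry MonoidalCategory CartesianMonoidalCategory
open scoped MonObj

namespace Literature.AlgebraicGeometry.Motives.AbelianVariety

variable {k : Type u} [Field k] (p : ℕ) [ExpChar k p] (n : ℕ) (A : AbelianVariety k)

/-! ### §1 `V ≫ F = [q]` on the twist -/

/-- **The other Verschiebung identity: `V ≫ F_{A∕k} = [q]_{A^{(q)}}`** for any `V : A^{(q)} → A` with `F_{A∕k} ≫ V = [q]_A`
(`F ≫ (V ≫ F) = [q] ≫ F = F ≫ [q]` and `F` is an isogeny, hence left-cancellable ★ `IsIsogeny.cancel_left`).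
[cite: EdixhovenVanDerGeerMoonenAV, Ch. 5 §2 (Verschiebung, `F ∘ V = [p]`, `V ∘ F = [p]`)] [cite: GortzWedhorn2023, Prop. 27.182 (p. 885)] -/
theorem comp_relFrobenius_eq_zsmul_id_of_relFrobenius_comp_eq (V : A.frobeniusTwist p n ⟶ A)
    (hV : A.relFrobenius p n ≫ V = ((p ^ n : ℕ) : ℤ) • 𝟙 A) :
    V ≫ A.relFrobenius p n = ((p ^ n : ℕ) : ℤ) • 𝟙 (A.frobeniusTwist p n) := by
  apply (A.isIsogeny_relFrobenius p n).cancel_left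
  rw [← Category.assoc, hV, Preadditive.zsmul_comp, Preadditive.comp_zsmul, Category.id_comp, Category.comp_id]

end Literature.AlgebraicGeometry.Motives.AbelianVariety

namespace Literature.AlgebraicGeometry.AbelianSchemes

namespace AbelianSchemeOver

namespace DualPair

open Literature.AlgebraicGeometry.Motives Literature.AlgebraicGeometry.Motives.AbelianVariety

variable {k : Type u} [Field k] [PerfectField k] (p : ℕ) [Fact p.Prime] [CharP k p] (m : ℕ) (A : AbelianVariety k)
  (D : (AbelianScheme.ofAbelianVariety A).toOver.DualPair)

/-! ### §2 `(V_A)^∨ = F_{Â}` -/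

/-- `dualIsogenyOver` depends only on the homomorphism (a `private` copy of ★ `DualPair.dualIsogeny_congr`, as in ★ (DF)).
[cite: MilneAV2008, I §9 Thm. 9.1 (p. 42)] -/
private theorem dualIsogenyOver_congr_aux {S : Scheme.{u}} {A' B : AbelianSchemeOver S} {ψ ψ' : A'.X ⟶ B.X} [IsMonHom ψ] [IsMonHom ψ']
    (h : ψ = ψ') (D' : A'.DualPair) (DB : B.DualPair) : dualIsogenyOver ψ D' DB = dualIsogenyOver ψ' D' DB := by
  subst h
  rfl

/-- **THE DUAL OF THE VERSCHIEBUNG IS THE FROBENIUS: `(V_A)^∨ = F_{Â}`** as `k`-morphisms `Â → Â^{(q)}`, for a dual pair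
`D = (Â, 𝒫)` of `A` with the unit hypothesis, the dual pair `D^{(q)}` of `A^{(q)}` (★ `DualPair.frobeniusTwist`) and ANY `V : A^{(q)} → A` with
`F_A ≫ V = [q]_A` (the Verschiebung of ★ `existsUnique_relFrobenius_comp_eq_pow_zsmul_id`).  PROOF: with `V_{Â} = (F_A)^∨` (★ (DF)
`hom_eq_dualIsogenyOver_relFrobenius`) and functoriality `(V ≫ F_A)^∨ = (F_A)^∨ ≫ V^∨` (★ `dualIsogenyOver_comp`):
`V_{Â} ≫ V^∨ = ([q]_{A^{(q)}})^∨ = [q]_{Â^{(q)}}` (§1 and ★ `dualIsogenyOver_mulN`); also `V_{Â} ≫ F_{Â} = [q]_{Â^{(q)}}` (§1 for `Â`); cancel the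
isogeny `V_{Â}` on the left (★ `IsIsogeny.cancel_left`). [cite: Oda1969, §1 Cor. 1.3] [cite: MumfordAV1970, §15 Thm. 1 (p. 143)]
[cite: EdixhovenVanDerGeerMoonenAV, (5.21), (7.34)] -/
theorem dualIsogenyOver_verschiebung_eq_relFrobenius
    (hD : Nonempty ((Scheme.Modules.pullback (unitHatSlice D)).obj D.P ≅ SheafOfModules.unit _))
    (V : A.frobeniusTwist p m ⟶ A) (hV : A.relFrobenius p m ≫ V = ((p ^ m : ℕ) : ℤ) • 𝟙 A) :
    dualIsogenyOver (A' := (AbelianScheme.ofAbelianVariety (A.frobeniusTwist p m)).toOver)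
        (B := (AbelianScheme.ofAbelianVariety A).toOver) V.hom.hom.hom (D.frobeniusTwist p m A) D =
      ((D.hat.toAffine.toAbelianVariety).relFrobenius p m).hom.hom.hom := by
  haveI : ExpChar k p := ExpChar.prime Fact.out
  -- notation: `Â`, its Frobenius `F̂`, its Verschiebung `V̂`
  set Ah : AbelianVariety k := D.hat.toAffine.toAbelianVariety with hAh
  have hDq := D.nonempty_unitHatSlice_frobeniusTwist_iso p m A hD
  obtain ⟨Vh, hVh, -⟩ := Ah.existsUnique_relFrobenius_comp_eq_pow_zsmul_id p m
  -- `V̂ = (F_A)^∨`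
  have hVhF : Vh.hom.hom.hom = dualIsogenyOver (A' := (AbelianScheme.ofAbelianVariety A).toOver)
      (B := (AbelianScheme.ofAbelianVariety (A.frobeniusTwist p m)).toOver)
      (A.relFrobenius p m).hom.hom.hom D (D.frobeniusTwist p m A) :=
    D.hom_eq_dualIsogenyOver_relFrobenius p m A hD Vh hVh
  -- `V^∨` is a homomorphism; package it as a morphism of abelian varieties `Â ⟶ Â^{(q)}`
  haveI hmon : IsMonHom (dualIsogenyOver (A' := (AbelianScheme.ofAbelianVariety (A.frobeniusTwist p m)).toOver)
      (B := (AbelianScheme.ofAbelianVariety A).toOver) V.hom.hom.hom (D.frobeniusTwist p m A) D) :=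
    isMonHom_dualIsogenyOver _ (D.frobeniusTwist p m A) D hD hDq
  let X : Ah ⟶ Ah.frobeniusTwist p m := homOfIsMonHom
    (dualIsogenyOver (A' := (AbelianScheme.ofAbelianVariety (A.frobeniusTwist p m)).toOver)
      (B := (AbelianScheme.ofAbelianVariety A).toOver) V.hom.hom.hom (D.frobeniusTwist p m A) D)
  -- `V̂ ≫ V^∨ = (V ≫ F_A)^∨ = ([q])^∨ = [q]`
  have h1 : Vh ≫ X = ((p ^ m : ℕ) : ℤ) • 𝟙 (Ah.frobeniusTwist p m) := by
    apply AbelianVariety.hom_ext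
    rw [AbelianVariety.comp_hom]
    change Vh.hom.hom.hom ≫ dualIsogenyOver _ (D.frobeniusTwist p m A) D = _
    rw [hVhF, ← dualIsogenyOver_comp, AbelianVariety.hom_zsmul_id, zpow_natCast]
    -- `V ≫ F_A = [q]_{A^{(q)}}`, on underlying `k`-morphisms `= mulN q`
    have hVF : V.hom.hom.hom ≫ (A.relFrobenius p m).hom.hom.hom =
        (AbelianScheme.ofAbelianVariety (A.frobeniusTwist p m)).toOver.mulN (p ^ m) := by
      have e := congrArg (fun f => f.hom.hom.hom) (A.comp_relFrobenius_eq_zsmul_id_of_relFrobenius_comp_eq p m V hV)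
      simp only [AbelianVariety.comp_hom] at e
      change V.hom.hom.hom ≫ (A.relFrobenius p m).hom.hom.hom = _ at e
      rw [e, AbelianVariety.hom_zsmul_id, zpow_natCast]
      rfl
    haveI : IsCommMonObj (AbelianScheme.ofAbelianVariety (A.frobeniusTwist p m)).toOver.X :=
      (AbelianScheme.ofAbelianVariety (A.frobeniusTwist p m)).toOver.isCommMonObj_of_isReduced_base
    haveI : IsMonHom ((AbelianScheme.ofAbelianVariety (A.frobeniusTwist p m)).toOver.mulN (p ^ m)) :=
      (AbelianScheme.ofAbelianVariety (A.frobeniusTwist p m)).toOver.isMonHom_mulN (p ^ m)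
    rw [dualIsogenyOver_congr_aux hVF]
    exact (D.frobeniusTwist p m A).dualIsogenyOver_mulN hDq (p ^ m)
  -- `V̂ ≫ F̂ = [q]`
  have h2 : Vh ≫ Ah.relFrobenius p m = ((p ^ m : ℕ) : ℤ) • 𝟙 (Ah.frobeniusTwist p m) :=
    Ah.comp_relFrobenius_eq_zsmul_id_of_relFrobenius_comp_eq p m Vh hVh
  have h3 : X = Ah.relFrobenius p m :=
    (Ah.isIsogeny_of_relFrobenius_comp_eq_zsmul_id p m Vh hVh).cancel_left (h1.trans h2.symm)
  exact congrArg (fun f => f.hom.hom.hom) h3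

end DualPair

end AbelianSchemeOver

end Literature.AlgebraicGeometry.AbelianSchemes

end
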